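import Literature.AnabelianGeometry.EtaleTheta.Discharge.Sec4Prop43iiiCocycle
import Literature.AnabelianGeometry.EtaleTheta.Discharge.Sec4Prop43ii
import HarnessLib

/-!
# [EtTh] Prop 4.3 (ii)/(iii) complement: two fraction-pairs on the SAME `N`-th-root objects with EQUAL divisors —
# their bi-Kummer difference cocycles differ by the Kummer cocycle `h ↦ s''{}^{gp}(h)·u·s''{}^{gp}(h)⁻¹·u⁻¹` of a UNIT
# `u ∈ O^×(B_N)` (GAP-LEDGER G-L2d3-8 (a); proof-only)

S. Mochizuki, *The étale theta function and its Frobenioid-theoretic manifestations*, Publ. RIMS **45** (2009) [EtTh],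
§4: Prop 4.3 (ii)/(iii) printed p.317 (PDF p.91) («(a) simultaneous conjugation by an element `ζ_Aut ∈ O^×(B_N)`,
followed by (b) non-simultaneous conjugation … by an element `u ∈ μ_N(B_N)`»; «the difference `s'_N{}^{gp}·(s''_N{}^{gp})⁻¹`
determines a twisted homomorphism … equal to the Kummer class `κ_{f|_{B_N}}`»), §5 Thm 5.7 p.330 (PDF p.104) («possible
translation by an element of … `l·ℤ`»), Thm 5.6 proof p.329 (PDF p.103) (the constant `u ∈ O^×(T₂)` with `u ∘ γ₂ ∘ s = t ∘ γ₁`);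
[FrdI] Thm 5.2 (ii) p.101 / Def 1.3 (iii)(d) (base-isomorphisms out of `X` are classified by `(deg_Fr, Div)` up to a unique
unit) [cite: MochizukiEtTh2009, Prop 4.3 (iii) p.317 (PDF p.91); MochizukiFrdI2008, Thm. 5.2(ii) p.101].

Cell abc-iut, layer L2, seat abc-iut-w6-d050 (gen 5), row «(γ) G-L2d3-8 (a)» of abc-iut-L2-lead (gen 6) R743/R755 —
GAP-LEDGER G-L2d3-8 (abc-iut-L2-d3 g7) disposition (a): «[BiKummerSetting generality] two `N`-th-root fraction pairs with EQUAL
num/den divisors have bi-Kummer difference cocycles differing by the Kummer cocycle `h ↦ s⊔-gp(h)·u·s⊔-gp(h)⁻¹·u⁻¹` of a unit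
`u ∈ O^×(B_N)`» (the (SEP)/(T3) clause of the EtTh:Thm5.7 (C)-chain; consumer = the v6 étale half, R754 (e1)).
PROOF-ONLY (0 `def`, 0 `instance`, no new `Prop`), over abc-iut-L2-t3's `BiKummerRoots.lean` (`NthRoot`, `BiKummerRoot`:
`striv`/`ident`/`sNum`/`sDen`), abc-iut-w6-d077's `Sec4Prop43iiiCocycle` (the difference cocycle `c(k) := s'{}^{gp}(k)·s''{}^{gp}(k)⁻¹`,
`O^×(B_N)` commutative normal), abc-iut-w5-d063's `Sec4Prop43ii` (`NthRoot.exists_units_lift`, `ModelFrobenioid.aut_conj_of_comp_eq`)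
and abc-iut-L6-t12's [FrdI] model lemmas (`exists_iso_comp_eq_of_div_eq`, `cancel_left_of_isIso_baseMap`) — all BY NAME:
* §1 (pure group algebra in `Aut_C(B_N)`) `BiKummerRoot.diff_conj_units_eq_mul_unitCocycle` — if `t'{}^{gp}(k) = ζ₁·s'{}^{gp}(k)·ζ₁⁻¹`
  and `t''{}^{gp}(k) = ζ₂·s''{}^{gp}(k)·ζ₂⁻¹` with `ζ₁, ζ₂ ∈ O^×(B_N)`, then
  `t'{}^{gp}(k)·t''{}^{gp}(k)⁻¹ = c(k) · (s''{}^{gp}(k)·u·s''{}^{gp}(k)⁻¹·u⁻¹)` with `u := ζ₁⁻¹·ζ₂` (the simultaneous part cancels,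
  exactly as in Prop 4.3 (ii)(a); only the quotient `u` of the two twists survives);
* §2 (model Frobenioid, total epimorphicity) `aut_eq_conj_mul_of_lifts` — a section of the unit-twisted pre-step `t = s ≫ ζ`
  over the `O^×(A_N)`-conjugate trivialisation `ζ_A·τ·ζ_A⁻¹` is `(ζ·ζ_B)·σ·(ζ·ζ_B)⁻¹`, where `σ` is the section of `s` over `τ` and
  `ζ_B` lifts `ζ_A` along `s` ([FrdI] Def 1.3 (iii)(d); abc-iut-w5-d063's `aut_conj_of_comp_eq`);
* §3 `NthRoot.exists_unit_num_comp_eq_of_div_eq` / `_den_` — EQUAL DIVISOR (and equal base map) ⇒ the second pre-step IS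
  `s'_N ≫ ζ₁` (resp. `s''_N ≫ ζ₂`) for a unit `ζ_i ∈ O^×(B_N)` ([FrdI] Thm 5.2 (ii), `exists_iso_comp_eq_of_div_eq`);
* §4 **`BiKummerRoot.exists_units_diff_eq_mul_unitCocycle_of_div_eq`** — THE LEMMA (a): for a bi-Kummer `N`-th root `K` of
  `(s'_N, s''_N)` and ANY pair of pre-steps `(t', t'') : A_N → B_N` with the same base maps and the SAME DIVISORS as `(s'_N, s''_N)`,
  carrying sections `t'{}^{gp}, t''{}^{gp} : H_{B_N} → Aut_C(B_N)` over an `O^×(A_N)`-conjugate `ζ_A·s_N^triv·ζ_A⁻¹` of `K`'s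
  trivialisation (same identification `H_{A_N} ≅ H_{B_N}`): there are units `ζ₁, ζ₂ ∈ O^×(B_N)` with `t' = s'_N ≫ ζ₁`,
  `t'' = s''_N ≫ ζ₂` and, for EVERY `k ∈ H_{B_N}`, `t'{}^{gp}(k)·t''{}^{gp}(k)⁻¹ = c_K(k)·(s''{}^{gp}(k)·u·s''{}^{gp}(k)⁻¹·u⁻¹)`,
  `u = ζ₁⁻¹ζ₂`; and the NORMALISED form **`BiKummerRoot.diff_eq_mul_unitCocycle_of_normalised`** (`t' = s'_N` on the nose,
  `t'' = s''_N ≫ w`: the correction is the Kummer cocycle of `w` itself) — the shape of a normalised transport `(a, b, w)` of the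
  [EtTh] Thm 5.7 knit (`hT : a⁻¹ ≫ Ψ s⊓ ≫ b = s⊓`, `hT′ : a⁻¹ ≫ Ψ s⊔ ≫ b = s⊔ ≫ w`).
What (a) does NOT contain (GAP (b), a STRUCTURAL binder of the consumer): that `w` is pulled back from `O^×(A_⊚)`, hence Π_X-fixed, so
that its Kummer cocycle is `G_K`-inflated.  HONEST FRAMING: elementary algebra over the typed §4 setting; [EtTh]/[FrdI] are
refereed and nothing of them is asserted; no side is taken on [IUTchIII] Cor 3.12; typed ≠ proved.
-/

noncomputable section

namespace Literature.AnabelianGeometry.EtaleTheta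

open CategoryTheory Opposite Literature.AlgebraicGeometry.Frobenioids

namespace BiKummerSetting

universe u₀ v₀ u v w

variable {K : Type u₀} [Field K]
variable {X : SemiGraphs.TemperedArithmeticGroup.{u₀} K} {D₀ : Type u₀} [Category.{v₀} D₀] {V : FrdIMonoidStub.{w}}
  {T : RealifiedDivisorMonoids (D₀ := D₀) V} {D : Type u} [Category.{v} D]
  {VD : FrdICatStub.{u, v, w} D} {S : BiKummerSetting X T D VD}

/-! ## §2. Sections over a unit-twisted pre-step (model Frobenioid: total epimorphicity) -/

/-- **A section over the unit-twisted pre-step `t = s ≫ ζ` is the `(ζ·ζ_B)`-conjugate of the section over `s`.**  If `σ`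
lifts `τ` along `s` (`s ≫ σ = τ ≫ s`), `ζ_B` lifts `ζ_A` along `s`, and `σ'` lifts the conjugate `ζ_A·τ·ζ_A⁻¹` along
`t = s ≫ ζ`, then `σ' = (ζ·ζ_B)·σ·(ζ·ζ_B)⁻¹` in `Aut_C(Y)` (`s` an epimorphism of the model Frobenioid: `Base(s)` iso,
`Φ` divisorial, `B` group-like). [cite: MochizukiFrdI2008, Thm. 5.2(ii) p.101] -/
theorem aut_eq_conj_mul_of_lifts (hΦd : Objectwise (fun M _ => IsDivisorial M) S.tf.divisorMonoid)
    (hBg : Objectwise (fun M _ => IsGroupLike M) S.tf.ratFnFunctor) {A' B' : S.C} (s : A' ⟶ B')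
    (hs : IsIso (ModelFrobenioid.baseMap s)) {τ ζA : Aut A'} {σ σ' ζ ζB : Aut B'}
    (hσ : s ≫ σ.hom = τ.hom ≫ s) (hζB : s ≫ ζB.hom = ζA.hom ≫ s)
    (hσ' : (s ≫ ζ.hom) ≫ σ'.hom = (ζA * τ * ζA⁻¹).hom ≫ (s ≫ ζ.hom)) :
    σ' = (ζ * ζB) * σ * (ζ * ζB)⁻¹ := by
  haveI := hs
  -- `ζ⁻¹ σ' ζ` lifts `ζ_A τ ζ_A⁻¹` along `s`
  have hlift : s ≫ (ζ⁻¹ * σ' * ζ).hom = (ζA * τ * ζA⁻¹).hom ≫ s := by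
    have e : (ζ⁻¹ * σ' * ζ).hom = ζ.hom ≫ σ'.hom ≫ ζ.inv := by
      simp only [Aut.Aut_mul_def, Aut.Aut_inv_def, Iso.trans_hom, Iso.symm_hom]
    have h' := hσ' =≫ ζ.inv
    simp only [Category.assoc, Iso.hom_inv_id, Category.comp_id] at h'
    rw [e]
    exact h'
  have hc := ModelFrobenioid.aut_conj_of_comp_eq hΦd hBg s hσ hlift hζB rfl
  calc σ' = ζ * (ζ⁻¹ * σ' * ζ) * ζ⁻¹ := by group
    _ = ζ * (ζB * σ * ζB⁻¹) * ζ⁻¹ := by rw [hc]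
    _ = (ζ * ζB) * σ * (ζ * ζB)⁻¹ := by group

namespace NthRoot

variable {A B : S.C} {f : S.biratUnits A} {P : S.FractionPair f B} {N : ℕ+}
  {pullFrac : ∀ {A A' : S.C} (_ : A' ⟶ A), S.biratUnits A → S.biratUnits A'}
  (R : S.NthRoot f P N pullFrac)

/-! ## §3. Equal divisors ⇒ the pre-steps differ by a unit of `B_N` ([FrdI] Thm 5.2 (ii)) -/

/-- **A pre-step `t' : A_N → B_N` with the base map and the DIVISOR of `s'_N` IS `s'_N ≫ ζ₁` for a unit `ζ₁ ∈ O^×(B_N)`**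
([FrdI] Def 1.3 (iii)(d) for the model: base-isomorphisms out of `A_N` are classified by `(deg_Fr, Div)` up to an isomorphism of
the target, `exists_iso_comp_eq_of_div_eq`; the comparison isomorphism is base-identity because the base maps agree).
[cite: MochizukiFrdI2008, Thm. 5.2(ii) p.101] -/
theorem exists_unit_num_comp_eq_of_div_eq (hBg : Objectwise (fun M _ => IsGroupLike M) S.tf.ratFnFunctor)
    {t : R.AN ⟶ R.BN} (ht : S.IsPreStep t)
    (hbase : ModelFrobenioid.baseMap t = ModelFrobenioid.baseMap R.pair.num)
    (hdiv : ModelFrobenioid.div t = ModelFrobenioid.div R.pair.num) :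
    ∃ ζ : Aut R.BN, ζ ∈ S.units R.BN ∧ R.pair.num ≫ ζ.hom = t := by
  haveI : IsIso (ModelFrobenioid.baseMap R.pair.num) := R.pair.isPreStep_num.2
  haveI : IsIso (ModelFrobenioid.baseMap t) := ht.2
  have hd₁ : ModelFrobenioid.degFr R.pair.num = 1 := R.pair.isPreStep_num.1
  have hd₂ : ModelFrobenioid.degFr t = 1 := ht.1
  obtain ⟨v, hv⟩ := ModelFrobenioid.exists_iso_comp_eq_of_div_eq hBg R.pair.num t (by rw [hd₁, hd₂]) hdiv.symm
  refine ⟨v, ⟨?_, (ModelFrobenioid.degFr_hom_eq_one v).1⟩, hv⟩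
  have e := congrArg ModelFrobenioid.baseMap hv
  rw [ModelFrobenioid.baseMap_comp, hbase] at e
  exact (cancel_epi (ModelFrobenioid.baseMap R.pair.num)).mp (e.trans (Category.comp_id _).symm)

/-- The same for the denominator `s''_N`. [cite: MochizukiFrdI2008, Thm. 5.2(ii) p.101] -/
theorem exists_unit_den_comp_eq_of_div_eq (hBg : Objectwise (fun M _ => IsGroupLike M) S.tf.ratFnFunctor)
    {t : R.AN ⟶ R.BN} (ht : S.IsPreStep t)
    (hbase : ModelFrobenioid.baseMap t = ModelFrobenioid.baseMap R.pair.den)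
    (hdiv : ModelFrobenioid.div t = ModelFrobenioid.div R.pair.den) :
    ∃ ζ : Aut R.BN, ζ ∈ S.units R.BN ∧ R.pair.den ≫ ζ.hom = t := by
  haveI : IsIso (ModelFrobenioid.baseMap R.pair.den) := R.pair.isPreStep_den.2
  haveI : IsIso (ModelFrobenioid.baseMap t) := ht.2
  have hd₁ : ModelFrobenioid.degFr R.pair.den = 1 := R.pair.isPreStep_den.1
  have hd₂ : ModelFrobenioid.degFr t = 1 := ht.1
  obtain ⟨v, hv⟩ := ModelFrobenioid.exists_iso_comp_eq_of_div_eq hBg R.pair.den t (by rw [hd₁, hd₂]) hdiv.symm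
  refine ⟨v, ⟨?_, (ModelFrobenioid.degFr_hom_eq_one v).1⟩, hv⟩
  have e := congrArg ModelFrobenioid.baseMap hv
  rw [ModelFrobenioid.baseMap_comp, hbase] at e
  exact (cancel_epi (ModelFrobenioid.baseMap R.pair.den)).mp (e.trans (Category.comp_id _).symm)

end NthRoot

namespace BiKummerRoot

variable {A B : S.C} {f : S.biratUnits A} {P : S.FractionPair f B} {N : ℕ+}
  {pullFrac : ∀ {A A' : S.C} (_ : A' ⟶ A), S.biratUnits A → S.biratUnits A'}
  {R : S.NthRoot f P N pullFrac} {hA : S.IsGalois R.AN} {hB : S.IsGalois R.BN}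
  (Kr : S.BiKummerRoot R hA hB)

/-! ## §1. The group algebra: unit-conjugate section pairs have difference cocycles differing by `∂u`, `u = ζ₁⁻¹ζ₂` -/

/-- **Unit-conjugate section pairs: the difference cocycles differ by the Kummer cocycle of `u := ζ₁⁻¹·ζ₂`.**  In
`Aut_C(B_N)` with its commutative normal subgroup `O^×(B_N)`: if `t'{}^{gp}(k) = ζ₁·s'{}^{gp}(k)·ζ₁⁻¹` and
`t''{}^{gp}(k) = ζ₂·s''{}^{gp}(k)·ζ₂⁻¹` (`ζ₁, ζ₂ ∈ O^×(B_N)`), then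
`t'{}^{gp}(k)·t''{}^{gp}(k)⁻¹ = (s'{}^{gp}(k)·s''{}^{gp}(k)⁻¹) · (s''{}^{gp}(k)·u·s''{}^{gp}(k)⁻¹·u⁻¹)`.  (The simultaneous
conjugation cancels as in Prop 4.3 (ii)(a), cf. abc-iut-w6-d077's `diff_eq_of_conj`; the quotient `u` of the two twists survives
as the coboundary-shaped term.) [cite: MochizukiEtTh2009, Prop 4.3 (iii) p.317 (PDF p.91)] -/
theorem diff_conj_units_eq_mul_unitCocycle {t₁ t₂ ζ₁ ζ₂ : Aut R.BN} (hζ₁ : ζ₁ ∈ S.units R.BN)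
    (hζ₂ : ζ₂ ∈ S.units R.BN) (k : S.HA R.BN hB) (ht₁ : t₁ = ζ₁ * Kr.sNum k * ζ₁⁻¹)
    (ht₂ : t₂ = ζ₂ * Kr.sDen k * ζ₂⁻¹) :
    t₁ * t₂⁻¹ =
      (Kr.sNum k * (Kr.sDen k)⁻¹) * (Kr.sDen k * (ζ₁⁻¹ * ζ₂) * (Kr.sDen k)⁻¹ * (ζ₁⁻¹ * ζ₂)⁻¹) := by
  subst ht₁ ht₂
  -- `w := s' (ζ₁⁻¹ζ₂) s''⁻¹ ζ₂⁻¹ = c · (s'' (ζ₁⁻¹ζ₂) s''⁻¹) · ζ₂⁻¹` is a unit, hence commutes with `ζ₁`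
  have hw : Kr.sNum k * (ζ₁⁻¹ * ζ₂) * (Kr.sDen k)⁻¹ * ζ₂⁻¹ ∈ S.units R.BN := by
    have e : Kr.sNum k * (ζ₁⁻¹ * ζ₂) * (Kr.sDen k)⁻¹ * ζ₂⁻¹ =
        (Kr.sNum k * (Kr.sDen k)⁻¹) * (Kr.sDen k * (ζ₁⁻¹ * ζ₂) * (Kr.sDen k)⁻¹) * ζ₂⁻¹ := by group
    rw [e]
    exact (S.units R.BN).mul_mem ((S.units R.BN).mul_mem (Kr.sNum_mul_sDen_inv_mem_units k)
      (S.conj_mem_units _ ((S.units R.BN).mul_mem ((S.units R.BN).inv_mem hζ₁) hζ₂)))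
      ((S.units R.BN).inv_mem hζ₂)
  have hc := S.units_comm hζ₁ hw
  calc ζ₁ * Kr.sNum k * ζ₁⁻¹ * (ζ₂ * Kr.sDen k * ζ₂⁻¹)⁻¹
      = ζ₁ * (Kr.sNum k * (ζ₁⁻¹ * ζ₂) * (Kr.sDen k)⁻¹ * ζ₂⁻¹) := by group
    _ = (Kr.sNum k * (ζ₁⁻¹ * ζ₂) * (Kr.sDen k)⁻¹ * ζ₂⁻¹) * ζ₁ := hc
    _ = (Kr.sNum k * (Kr.sDen k)⁻¹) * (Kr.sDen k * (ζ₁⁻¹ * ζ₂) * (Kr.sDen k)⁻¹ * (ζ₁⁻¹ * ζ₂)⁻¹) := by group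

/-- The correction term is the same through `s'{}^{gp}` as through `s''{}^{gp}` (the two conjugations agree on `O^×(B_N)`, their
quotient `c(k)` being a unit) and as through `k ∈ H_{B_N} ⊆ Aut_C(B_N)` itself. [cite: MochizukiEtTh2009, Prop 4.3 (iii) p.317 (PDF p.91)] -/
theorem unitCocycle_sDen_eq (k : S.HA R.BN hB) {u : Aut R.BN} (hu : u ∈ S.units R.BN) :
    Kr.sDen k * u * (Kr.sDen k)⁻¹ * u⁻¹ = Kr.sNum k * u * (Kr.sNum k)⁻¹ * u⁻¹ ∧
      Kr.sDen k * u * (Kr.sDen k)⁻¹ * u⁻¹ = (k : Aut R.BN) * u * (k : Aut R.BN)⁻¹ * u⁻¹ := by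
  refine ⟨?_, ?_⟩
  · rw [S.conj_eq_conj_of_mul_inv_mem_units (Kr.sNum_mul_sDen_inv_mem_units k) hu]
  · rw [S.conj_eq_conj_of_mul_inv_mem_units (Kr.sDen_mul_inv_mem_units k) hu]

/-! ## §4. THE LEMMA (GAP G-L2d3-8 (a)): equal divisors ⇒ difference cocycles differ by a unit's Kummer cocycle -/

/-- **Two fraction-pairs on the same `N`-th-root objects with EQUAL divisors have bi-Kummer difference cocycles differing by
the Kummer cocycle of a unit.**  Let `K` be a bi-Kummer `N`-th root of `(s'_N, s''_N) : A_N → B_N`; let `(t', t'')` be pre-steps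
`A_N → B_N` with the same base maps and `Div(t') = Div(s'_N)`, `Div(t'') = Div(s''_N)`, and let `t'{}^{gp}, t''{}^{gp} : H_{B_N} →
Aut_C(B_N)` be sections of `t'`, `t''` over the `O^×(A_N)`-conjugate trivialisation `ζ_A·s_N^triv·ζ_A⁻¹` (`ζ_A ∈ O^×(A_N)`; same
identification `H_{A_N} ≅ H_{B_N}`).  Then `t' = s'_N ≫ ζ₁`, `t'' = s''_N ≫ ζ₂` for units `ζ₁, ζ₂ ∈ O^×(B_N)` and, for every
`k ∈ H_{B_N}`, `t'{}^{gp}(k)·t''{}^{gp}(k)⁻¹ = c_K(k)·(s''{}^{gp}(k)·u·s''{}^{gp}(k)⁻¹·u⁻¹)` with `u := ζ₁⁻¹·ζ₂ ∈ O^×(B_N)` —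
modulo `Φ` divisorial and `B` group-like ([FrdI] Thm 5.2 (ii)). [cite: MochizukiEtTh2009, Prop 4.3 (iii) p.317 (PDF p.91)] -/
theorem exists_units_diff_eq_mul_unitCocycle_of_div_eq
    (hΦd : Objectwise (fun M _ => IsDivisorial M) S.tf.divisorMonoid)
    (hBg : Objectwise (fun M _ => IsGroupLike M) S.tf.ratFnFunctor)
    {t' t'' : R.AN ⟶ R.BN} (ht' : S.IsPreStep t') (ht'' : S.IsPreStep t'')
    (hb' : ModelFrobenioid.baseMap t' = ModelFrobenioid.baseMap R.pair.num)
    (hb'' : ModelFrobenioid.baseMap t'' = ModelFrobenioid.baseMap R.pair.den)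
    (hdiv' : ModelFrobenioid.div t' = ModelFrobenioid.div R.pair.num)
    (hdiv'' : ModelFrobenioid.div t'' = ModelFrobenioid.div R.pair.den)
    {ζA : Aut R.AN} (hζA : ζA ∈ S.units R.AN) (tNum tDen : S.HA R.BN hB →* Aut R.BN)
    (hcn : ∀ h : S.HA R.AN hA, t' ≫ (tNum (Kr.ident h)).hom = (ζA * Kr.striv h * ζA⁻¹).hom ≫ t')
    (hcd : ∀ h : S.HA R.AN hA, t'' ≫ (tDen (Kr.ident h)).hom = (ζA * Kr.striv h * ζA⁻¹).hom ≫ t'') :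
    ∃ ζ₁ ζ₂ : Aut R.BN, ζ₁ ∈ S.units R.BN ∧ ζ₂ ∈ S.units R.BN ∧
      R.pair.num ≫ ζ₁.hom = t' ∧ R.pair.den ≫ ζ₂.hom = t'' ∧
      ∀ k : S.HA R.BN hB, tNum k * (tDen k)⁻¹ =
        (Kr.sNum k * (Kr.sDen k)⁻¹) * (Kr.sDen k * (ζ₁⁻¹ * ζ₂) * (Kr.sDen k)⁻¹ * (ζ₁⁻¹ * ζ₂)⁻¹) := by
  obtain ⟨ζ₁, hζ₁, h₁⟩ := R.exists_unit_num_comp_eq_of_div_eq hBg ht' hb' hdiv'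
  obtain ⟨ζ₂, hζ₂, h₂⟩ := R.exists_unit_den_comp_eq_of_div_eq hBg ht'' hb'' hdiv''
  -- the simultaneous lift `ζ_B ∈ O^×(B_N)` of `ζ_A` along `s'_N` AND `s''_N` (abc-iut-w5-d063)
  obtain ⟨ζB, hζB, hBn, hBd⟩ := R.exists_units_lift hΦd hBg hζA
  refine ⟨ζ₁, ζ₂, hζ₁, hζ₂, h₁, h₂, fun k => ?_⟩
  obtain ⟨h, rfl⟩ := Kr.ident.surjective k
  subst h₁ h₂
  have hn : tNum (Kr.ident h) = (ζ₁ * ζB) * Kr.sNum (Kr.ident h) * (ζ₁ * ζB)⁻¹ :=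
    aut_eq_conj_mul_of_lifts hΦd hBg R.pair.num R.pair.isPreStep_num.2 (Kr.comm_num h) hBn (hcn h)
  have hd : tDen (Kr.ident h) = (ζ₂ * ζB) * Kr.sDen (Kr.ident h) * (ζ₂ * ζB)⁻¹ :=
    aut_eq_conj_mul_of_lifts hΦd hBg R.pair.den R.pair.isPreStep_den.2 (Kr.comm_den h) hBd (hcd h)
  have hu : (ζ₁ * ζB)⁻¹ * (ζ₂ * ζB) = ζ₁⁻¹ * ζ₂ := by
    have hc : ζB⁻¹ * (ζ₁⁻¹ * ζ₂) = (ζ₁⁻¹ * ζ₂) * ζB⁻¹ :=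
      S.units_comm ((S.units R.BN).inv_mem hζB) ((S.units R.BN).mul_mem ((S.units R.BN).inv_mem hζ₁) hζ₂)
    calc (ζ₁ * ζB)⁻¹ * (ζ₂ * ζB) = ζB⁻¹ * (ζ₁⁻¹ * ζ₂) * ζB := by group
      _ = (ζ₁⁻¹ * ζ₂) * ζB⁻¹ * ζB := by rw [hc]
      _ = ζ₁⁻¹ * ζ₂ := by group
  rw [Kr.diff_conj_units_eq_mul_unitCocycle ((S.units R.BN).mul_mem hζ₁ hζB) ((S.units R.BN).mul_mem hζ₂ hζB)
    (Kr.ident h) hn hd, hu]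

/-- **NORMALISED form** (the shape of a normalised transport `(a, b, w)` of the Thm 5.7 knit: numerator transported ON THE NOSE,
denominator off by a unit `w ∈ O^×(B_N)`, same trivialisation up to `ζ_A ∈ O^×(A_N)`): sections `t'{}^{gp}, t''{}^{gp}` of
`(s'_N, s''_N ≫ w)` over `ζ_A·s_N^triv·ζ_A⁻¹` satisfy, for every `k ∈ H_{B_N}`,
`t'{}^{gp}(k)·t''{}^{gp}(k)⁻¹ = c_K(k) · (s''{}^{gp}(k)·w·s''{}^{gp}(k)⁻¹·w⁻¹)` — the bi-Kummer difference cocycle changes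
exactly by the Kummer cocycle of the unit `w`. [cite: MochizukiEtTh2009, Thm 5.7 p.330 (PDF p.104); Prop 4.3 (iii) p.317 (PDF p.91)] -/
theorem diff_eq_mul_unitCocycle_of_normalised
    (hΦd : Objectwise (fun M _ => IsDivisorial M) S.tf.divisorMonoid)
    (hBg : Objectwise (fun M _ => IsGroupLike M) S.tf.ratFnFunctor)
    {w : Aut R.BN} (hw : w ∈ S.units R.BN) {ζA : Aut R.AN} (hζA : ζA ∈ S.units R.AN)
    (tNum tDen : S.HA R.BN hB →* Aut R.BN)
    (hcn : ∀ h : S.HA R.AN hA, R.pair.num ≫ (tNum (Kr.ident h)).hom = (ζA * Kr.striv h * ζA⁻¹).hom ≫ R.pair.num)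
    (hcd : ∀ h : S.HA R.AN hA,
      (R.pair.den ≫ w.hom) ≫ (tDen (Kr.ident h)).hom = (ζA * Kr.striv h * ζA⁻¹).hom ≫ (R.pair.den ≫ w.hom))
    (k : S.HA R.BN hB) :
    tNum k * (tDen k)⁻¹ = (Kr.sNum k * (Kr.sDen k)⁻¹) * (Kr.sDen k * w * (Kr.sDen k)⁻¹ * w⁻¹) := by
  obtain ⟨ζB, hζB, hBn, hBd⟩ := R.exists_units_lift hΦd hBg hζA
  obtain ⟨h, rfl⟩ := Kr.ident.surjective k
  have hcn' : (R.pair.num ≫ (1 : Aut R.BN).hom) ≫ (tNum (Kr.ident h)).hom =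
      (ζA * Kr.striv h * ζA⁻¹).hom ≫ (R.pair.num ≫ (1 : Aut R.BN).hom) := by
    have e1 : (1 : Aut R.BN).hom = 𝟙 _ := rfl
    rw [e1, Category.comp_id]
    exact hcn h
  have hn : tNum (Kr.ident h) = (1 * ζB) * Kr.sNum (Kr.ident h) * (1 * ζB)⁻¹ :=
    aut_eq_conj_mul_of_lifts hΦd hBg R.pair.num R.pair.isPreStep_num.2 (Kr.comm_num h) hBn hcn'
  have hd : tDen (Kr.ident h) = (w * ζB) * Kr.sDen (Kr.ident h) * (w * ζB)⁻¹ :=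
    aut_eq_conj_mul_of_lifts hΦd hBg R.pair.den R.pair.isPreStep_den.2 (Kr.comm_den h) hBd (hcd h)
  have hu : (1 * ζB)⁻¹ * (w * ζB) = w := by
    have hc : ζB⁻¹ * w = w * ζB⁻¹ := S.units_comm ((S.units R.BN).inv_mem hζB) hw
    calc (1 * ζB)⁻¹ * (w * ζB) = ζB⁻¹ * w * ζB := by group
      _ = w * ζB⁻¹ * ζB := by rw [hc]
      _ = w := by group
  rw [Kr.diff_conj_units_eq_mul_unitCocycle ((S.units R.BN).mul_mem (S.units R.BN).one_mem hζB)
    ((S.units R.BN).mul_mem hw hζB) (Kr.ident h) hn hd, hu]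

/-- The same with the SAME trivialisation (`ζ_A = 1`) — the literal GAP-LEDGER G-L2d3-8 (a) sentence: sections of
`(s'_N, s''_N ≫ w)` over `s_N^triv` itself have difference cocycle `c_K · ∂w`, `∂w(k) = s''{}^{gp}(k)·w·s''{}^{gp}(k)⁻¹·w⁻¹`.
[cite: MochizukiEtTh2009, Prop 4.3 (iii) p.317 (PDF p.91)] -/
theorem diff_eq_mul_unitCocycle_of_normalised_sameTriv
    (hΦd : Objectwise (fun M _ => IsDivisorial M) S.tf.divisorMonoid)
    (hBg : Objectwise (fun M _ => IsGroupLike M) S.tf.ratFnFunctor)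
    {w : Aut R.BN} (hw : w ∈ S.units R.BN) (tNum tDen : S.HA R.BN hB →* Aut R.BN)
    (hcn : ∀ h : S.HA R.AN hA, R.pair.num ≫ (tNum (Kr.ident h)).hom = (Kr.striv h).hom ≫ R.pair.num)
    (hcd : ∀ h : S.HA R.AN hA, (R.pair.den ≫ w.hom) ≫ (tDen (Kr.ident h)).hom = (Kr.striv h).hom ≫ (R.pair.den ≫ w.hom))
    (k : S.HA R.BN hB) :
    tNum k * (tDen k)⁻¹ = (Kr.sNum k * (Kr.sDen k)⁻¹) * (Kr.sDen k * w * (Kr.sDen k)⁻¹ * w⁻¹) := by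
  refine Kr.diff_eq_mul_unitCocycle_of_normalised hΦd hBg hw (S.units R.AN).one_mem tNum tDen
    (fun h => ?_) (fun h => ?_) k
  · rw [one_mul, inv_one, mul_one]; exact hcn h
  · rw [one_mul, inv_one, mul_one]; exact hcd h

end BiKummerRoot

end BiKummerSetting

end Literature.AnabelianGeometry.EtaleTheta

end
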